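import Mathlib
import HarnessLib
import Summits.ValiantsHypothesis.ValiantsHypothesis.Theorems.SymmetryDialTranslationOrbits

/-!
# SymmetryDial — shift permutations: `E(ξ) = k_ξ² + k'_ξ²` (kernel (θ₁), part 2 of 3)

Route `route-ValiantsHypothesis-SymmetryDial`, item A₂ (stmt-ValiantsHypothesis-23711).
A permutation inside the group matrix `M_f` commuting with every translation of a hyperplane
`ker ξ` (`ξ ≠ 0`) is the SHIFT PERMUTATION `x ↦ x + s_{ξ·x}` of an ordered pair `(s₀, s₁)` of support
vectors in the same `ξ`-class, and conversely (`card_kerEqv`): their number is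
`E(ξ) = k_ξ² + k'_ξ²` with `k_ξ = kerCount f ξ = |S ∩ ker ξ|`, `k'_ξ = |S ∖ ker ξ|`.
-/

set_option linter.dupNamespace false

namespace Summit.ValiantsHypothesis.ValiantsHypothesis.Theorems.SymmetryDialShiftPerm

open Finset Equiv
open SymmetryDialAffinePebble (V pair)
open SymmetryDialAffinePebbleThree (grpMat kerCount)
open SymmetryDialPerCongruence (admissible mem_admissible two_nsmul_eq_zero)
open SymmetryDialTranslationOrbits

variable {d : ℕ}

/-- Every element of `Fin 2` is `0` or `1` (file-local copy of a two-line triviality). -/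
private theorem fin2_cases (a : Fin 2) : a = 0 ∨ a = 1 := by
  fin_cases a <;> simp

/-! ### 5. Permutations commuting with a hyperplane of translations: `E(ξ) = k_ξ² + k'_ξ²` -/

/-- `sel s₀ s₁ a = s₀` if `a = 0`, else `s₁`. -/
def sel (s₀ s₁ : V d) (a : Fin 2) : V d := if a = 0 then s₀ else s₁

/-- `sel s₀ s₁ 0 = s₀`. -/
@[simp] theorem sel_zero (s₀ s₁ : V d) : sel s₀ s₁ 0 = s₀ := by simp [sel]

/-- `sel s₀ s₁ 1 = s₁`. -/
@[simp] theorem sel_one (s₀ s₁ : V d) : sel s₀ s₁ 1 = s₁ := by simp [sel]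

/-- Both selected vectors lie in the class of `s₀`. -/
theorem pair_sel {ξ s₀ s₁ : V d} (h : pair ξ s₀ = pair ξ s₁) (a : Fin 2) :
    pair ξ (sel s₀ s₁ a) = pair ξ s₀ := by
  rcases fin2_cases a with rfl | rfl <;> simp [h]

/-- The shift map `x ↦ x + s_{ξ·x}`. -/
def shiftFun (ξ s₀ s₁ : V d) (x : V d) : V d := x + sel s₀ s₁ (pair ξ x)

/-- Its inverse `y ↦ y + s_{ξ·y + ξ·s₀}`. -/
def shiftInv (ξ s₀ s₁ : V d) (y : V d) : V d := y + sel s₀ s₁ (pair ξ y + pair ξ s₀)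

/-- The SHIFT PERMUTATION of two vectors in the same `ξ`-class: `x ↦ x + s₀` on `ker ξ`,
`x ↦ x + s₁` off it. -/
def shiftPerm (ξ s₀ s₁ : V d) (h : pair ξ s₀ = pair ξ s₁) : Perm (V d) where
  toFun := shiftFun ξ s₀ s₁
  invFun := shiftInv ξ s₀ s₁
  left_inv x := by
    simp only [shiftFun, shiftInv]
    rw [pair_add, pair_sel h, add_assoc (pair ξ x), fin2_add_self, add_zero, add_assoc, two_nsmul_eq_zero,
      add_zero]
  right_inv y := by
    simp only [shiftFun, shiftInv]
    rw [pair_add, pair_sel h, add_assoc, two_nsmul_eq_zero, add_zero]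

/-- `shiftPerm ξ s₀ s₁ _ x = x + s_{ξ·x}`. -/
@[simp] theorem shiftPerm_apply (ξ s₀ s₁ : V d) (h : pair ξ s₀ = pair ξ s₁) (x : V d) :
    shiftPerm ξ s₀ s₁ h x = x + sel s₀ s₁ (pair ξ x) := rfl

/-- Translations in `ker ξ` commute with the shift permutation. -/
theorem tconj_shiftPerm {ξ s₀ s₁ : V d} (h : pair ξ s₀ = pair ξ s₁) {t : V d} (ht : pair ξ t = 0) :
    tconj t (shiftPerm ξ s₀ s₁ h) = shiftPerm ξ s₀ s₁ h := by
  refine Equiv.ext fun x => ?_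
  simp only [tconj_apply, shiftPerm_apply, pair_add, ht, zero_add]
  rw [← add_assoc, add_add_cancel_left]

/-- The shift permutation of two support vectors lies inside the group matrix. -/
theorem shiftPerm_mem_admissible {f : V d → Bool} {ξ s₀ s₁ : V d} (h : pair ξ s₀ = pair ξ s₁)
    (h0 : f s₀ = true) (h1 : f s₁ = true) : shiftPerm ξ s₀ s₁ h ∈ admissible (grpMat f) := by
  rw [mem_admissible]
  intro i
  simp only [grpMat, shiftPerm_apply]
  rw [show i + sel s₀ s₁ (pair ξ i) + i = sel s₀ s₁ (pair ξ i) by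
    rw [add_comm, ← add_assoc, two_nsmul_eq_zero, zero_add]]
  rcases fin2_cases (pair ξ i) with hc | hc
  · rw [hc, sel_zero, h0]
  · rw [hc, sel_one, h1]

/-- **Structure of `ker ξ`-equivariant permutations**: they are shift maps. -/
theorem kerEquivariant_apply {σ : Perm (V d)} {ξ u : V d} (hu : pair ξ u = 1)
    (hσ : ∀ t, pair ξ t = 0 → tconj t σ = σ) (x : V d) :
    σ x = x + sel (σ 0) (u + σ u) (pair ξ x) := by
  rcases fin2_cases (pair ξ x) with hx | hx
  · have h := congrArg (fun τ : Perm (V d) => τ 0) (hσ x hx)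
    simp only [tconj_apply, add_zero] at h
    rw [hx, sel_zero, ← h, add_add_cancel_left]
  · have hxu : pair ξ (x + u) = 0 := by rw [pair_add, hx, hu]; decide
    have h := congrArg (fun τ : Perm (V d) => τ u) (hσ (x + u) hxu)
    simp only [tconj_apply] at h
    rw [add_assoc x u u, two_nsmul_eq_zero, add_zero] at h
    rw [hx, sel_one, ← h]
    symm
    calc x + (u + (x + u + σ x)) = (x + x) + (u + u) + σ x := by abel
      _ = σ x := by rw [two_nsmul_eq_zero, two_nsmul_eq_zero, zero_add, zero_add]

/-- … and bijectivity forces the two shift vectors into the same `ξ`-class. -/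
theorem pair_eq_of_kerEquivariant {σ : Perm (V d)} {ξ u : V d} (hu : pair ξ u = 1)
    (hσ : ∀ t, pair ξ t = 0 → tconj t σ = σ) : pair ξ (σ 0) = pair ξ (u + σ u) := by
  by_contra hne
  have key : ∀ x, pair ξ (σ x) = pair ξ x + pair ξ (sel (σ 0) (u + σ u) (pair ξ x)) := fun x => by
    conv_lhs => rw [kerEquivariant_apply hu hσ x]
    rw [pair_add]
  rcases fin2_cases (pair ξ (σ 0)) with h0 | h0
  · have h1 : pair ξ (u + σ u) = 1 := fin2_ne_zero_iff.1 fun h => hne (h0.trans h.symm)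
    obtain ⟨x, hx⟩ := σ.surjective u
    have hk := key x
    rw [hx, hu] at hk
    rcases fin2_cases (pair ξ x) with hc | hc
    · rw [hc, sel_zero, h0] at hk; exact absurd hk (by decide)
    · rw [hc, sel_one, h1] at hk; exact absurd hk (by decide)
  · have h1 : pair ξ (u + σ u) = 0 := by
      rcases fin2_cases (pair ξ (u + σ u)) with h | h
      · exact h
      · exact absurd (h0.trans h.symm) hne
    obtain ⟨x, hx⟩ := σ.surjective 0
    have hk := key x
    rw [hx, pair_zero_right] at hk
    rcases fin2_cases (pair ξ x) with hc | hc
    · rw [hc, sel_zero, h0] at hk; exact absurd hk (by decide)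
    · rw [hc, sel_one, h1] at hk; exact absurd hk (by decide)

/-- A `ker ξ`-equivariant permutation equals the shift permutation of `(σ 0, u + σ u)`. -/
theorem eq_shiftPerm {σ : Perm (V d)} {ξ u : V d} (hu : pair ξ u = 1)
    (hσ : ∀ t, pair ξ t = 0 → tconj t σ = σ) :
    σ = shiftPerm ξ (σ 0) (u + σ u) (pair_eq_of_kerEquivariant hu hσ) :=
  Equiv.ext fun x => by rw [shiftPerm_apply]; exact kerEquivariant_apply hu hσ x

/-- `E(ξ)`: the permutations inside `M_f` commuting with every translation of `ker ξ`. -/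
def kerEqv (f : V d → Bool) (ξ : V d) : Finset (Perm (V d)) :=
  (admissible (grpMat f)).filter fun σ => ∀ t, pair ξ t = 0 → tconj t σ = σ

/-- The support of `f`. -/
def supp (f : V d → Bool) : Finset (V d) := univ.filter fun v => f v = true

/-- `k'_ξ = #(supp f ∖ ker ξ)`, the complement count of `kerCount f ξ = #(supp f ∩ ker ξ)`. -/
def coKerCount (f : V d → Bool) (ξ : V d) : ℕ :=
  ((univ : Finset (V d)).filter fun v => f v = true ∧ ¬ pair ξ v = 0).card

/-- `k_ξ + k'_ξ = |S|`. -/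
theorem kerCount_add_coKerCount (f : V d → Bool) (ξ : V d) :
    kerCount f ξ + coKerCount f ξ = (supp f).card := by
  have h := card_filter_add_card_filter_not (s := supp f) (fun v => pair ξ v = 0)
  rw [supp, filter_filter, filter_filter] at h
  exact h

/-- `k_0 = |S|`. -/
theorem kerCount_zero_eq (f : V d → Bool) : kerCount f 0 = (supp f).card := by
  unfold kerCount supp
  congr 1
  exact filter_congr fun v _ => by simp [pair_zero_left]

/-- `k_ξ ≤ |S|`. -/
theorem kerCount_le (f : V d → Bool) (ξ : V d) : kerCount f ξ ≤ (supp f).card := by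
  rw [← kerCount_add_coKerCount f ξ]; exact Nat.le_add_right _ _

/-- **`E(ξ) = k_ξ² + k'_ξ²`** for `ξ ≠ 0`: a `ker ξ`-equivariant permutation inside `M_f` is the shift
permutation of an ordered pair of support vectors in the same `ξ`-class, and conversely. -/
theorem card_kerEqv {f : V d → Bool} {ξ : V d} (hξ : ξ ≠ 0) :
    (kerEqv f ξ).card = kerCount f ξ ^ 2 + coKerCount f ξ ^ 2 := by
  obtain ⟨u, hu⟩ := exists_pair_eq_one hξ
  have hcard : (kerEqv f ξ).card =
      (((supp f) ×ˢ (supp f)).filter fun p : V d × V d => pair ξ p.1 = pair ξ p.2).card := by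
    refine card_bij' (fun σ _ => (σ 0, u + σ u))
      (fun p hp => shiftPerm ξ p.1 p.2 (mem_filter.1 hp).2) ?_ ?_ ?_ ?_
    · intro σ hσ
      rw [kerEqv, mem_filter, mem_admissible] at hσ
      simp only [mem_filter, mem_product, supp, mem_univ, true_and]
      refine ⟨⟨?_, ?_⟩, pair_eq_of_kerEquivariant hu hσ.2⟩
      · simpa [grpMat] using hσ.1 0
      · simpa [grpMat, add_comm] using hσ.1 u
    · intro p hp
      simp only [mem_filter, mem_product, supp, mem_univ, true_and] at hp
      rw [kerEqv, mem_filter]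
      exact ⟨shiftPerm_mem_admissible _ hp.1.1 hp.1.2, fun t ht => tconj_shiftPerm _ ht⟩
    · intro σ hσ
      rw [kerEqv, mem_filter] at hσ
      exact (eq_shiftPerm hu hσ.2).symm
    · intro p hp
      simp [hu, add_add_cancel_left, pair_zero_right]
  have hsplit : (((supp f) ×ˢ (supp f)).filter fun p : V d × V d => pair ξ p.1 = pair ξ p.2) =
      ((univ : Finset (V d)).filter fun v => f v = true ∧ pair ξ v = 0) ×ˢ
        ((univ : Finset (V d)).filter fun v => f v = true ∧ pair ξ v = 0) ∪
      ((univ : Finset (V d)).filter fun v => f v = true ∧ ¬ pair ξ v = 0) ×ˢ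
        ((univ : Finset (V d)).filter fun v => f v = true ∧ ¬ pair ξ v = 0) := by
    ext ⟨a, b⟩
    simp only [mem_filter, mem_product, supp, mem_univ, true_and, mem_union]
    rcases fin2_cases (pair ξ a) with ha | ha <;> rcases fin2_cases (pair ξ b) with hb | hb <;>
      simp [ha, hb]
  have hdisj : Disjoint
      (((univ : Finset (V d)).filter fun v => f v = true ∧ pair ξ v = 0) ×ˢ
        ((univ : Finset (V d)).filter fun v => f v = true ∧ pair ξ v = 0))
      (((univ : Finset (V d)).filter fun v => f v = true ∧ ¬ pair ξ v = 0) ×ˢ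
        ((univ : Finset (V d)).filter fun v => f v = true ∧ ¬ pair ξ v = 0)) := by
    rw [disjoint_left]
    rintro ⟨a, b⟩ h1 h2
    simp only [mem_product, mem_filter, mem_univ, true_and] at h1 h2
    exact h2.1.2 h1.1.2
  rw [hcard, hsplit, card_union_of_disjoint hdisj, card_product, card_product, kerCount, coKerCount,
    sq, sq]

end Summit.ValiantsHypothesis.ValiantsHypothesis.Theorems.SymmetryDialShiftPerm
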